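import Summits.ResolutionOfSingularities.ResolutionOfSingularities.Theorems.FrobeniusClosingPatchingRelPerfectDepthTargetsR5H
import HarnessLib

/-!
# `PatchingRelPerfect` (stmt-ResolutionOfSingularities-16161), chain W5.2 — rung R5ᴴ: TARGETS, part 2 —
# the X-side targets over an INTEGRAL carrier (`HLedStateI`, `HLedStepI`, `HLedTowerI`) and the PROVED compositions

[OURS · L1 W5.2 · res-D-pv-055, owner of R5ᴴ (res-L1-w52-plan-1 RULING G10-2)] Sibling of `…DepthTargetsR5H` (unchanged,
imported). The X-side step target `HLedStep` there quantifies over EVERY `HLedState`, including degenerate ones (a reducible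
carrier `W`, a boundary member containing a whole component of `W`, a centre equal to a component) in which the weight-one
law `D ↦ τᶜ(D, 1)` still holds but needs separate case analyses. The states that actually OCCUR along the rung — from the
initial package `HLedPackage` on — have an INTEGRAL carrier met by every boundary member in an effective Cartier divisor, and
these two clauses propagate along the step (`IsBlowup.isIntegral`; controlled transforms / pull-backs of Cartier divisors).
This file records them (`HLedStateI`), restates the step and tower targets over them (`HLedStepI`, `HLedTowerI` — the E-side
targets `HSepSeq` / `HSepEnd` / `HSepGame₃` and the member data `HLedPackage` / `HLedInitial` are UNCHANGED), and re-proves the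
compositions down to the CORE shape: `hLedTowerI_of_step`, `hLedI_atomConclusion_of_targets : HSepGame₃ → HLedTowerI → every
`HLedPackage` member ∈ 𝒞`, `hLedMemberI_atomConclusion_of_targets : HLedInitial → HSepGame₃ → HLedStepI → every hypersurface-led
one-form member of every depth ∈ 𝒞`. The owner's N2 proves `HLedStepI`; with the integral carrier the off-centre identity
`τᶜ(D, 1) = τ^*D` for members missing the centre is the tree's `IsBlowup.strictTransformIdeal_eq_controlledTransform` at
generic weight `0` (Kollár 3.30.2), on `X` and on `W` alike.

Honest framing: OURS (AI-written, weaker than expert review); definitions and compositions of tree theorems; no fact is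
asserted or taken as antecedent; nothing here is a statement of the manuscript under review.

## Sources
* J. Kollár, *Lectures on Resolution of Singularities* (2007), (3.111) Step 3, 3.30.2. [Kollar2007]
* The Stacks Project, Tags 080A, 02ND (blowing up an integral scheme). [StacksProject]
-/

set_option linter.dupNamespace false -- mandated namespace of this single-conjunct summit

noncomputable section

open CategoryTheory CategoryTheory.Limits AlgebraicGeometry TopologicalSpace IsLocalRing
open Literature.AlgebraicGeometry.Resolution Literature.AlgebraicGeometry.Motives Scheme.IdealSheafData

namespace Summit.ResolutionOfSingularities.ResolutionOfSingularities.Theorems.DepthTargets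

universe u

/-! ## §1 The state over an integral carrier -/

/-- [OURS · L1 W5.2 · R5ᴴ] **The H-led state with INTEGRAL carrier**: an `HLedState` whose carrier `W` is integral and is met by
every boundary member in an effective Cartier divisor (`B|_W` effective Cartier — so no member contains `W`, and a centre lying
on a charged member is nowhere dense in `W`). Both clauses hold at the initial package and propagate along the weight-one step.
(cf. Kollár 2007 = bib Kollar2007, (3.111) Step 3 — OURS node; pointer in prose, the structure being a hypothesis package) -/
structure HLedStateI (S : Type u) [CommRing S] [IsRegularLocalRing S] (I : Ideal S) (W X : Scheme.{u}) (i : W ⟶ X)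
    (g : X ⟶ Spec (.of S)) (ℬ : List (X.IdealSheafData × ℕ)) : Prop
    extends HLedState S I W X i g ℬ where
  /-- the carrier is integral -/
  isIntegral_host : IsIntegral W
  /-- every boundary member meets the carrier in an effective Cartier divisor -/
  restrict_cartier : ∀ p ∈ ℬ, IsEffectiveCartier (p.1.comap i)

/-! ## §2 The X-side targets over integral carriers -/

/-- [OURS · L1 W5.2 · R5ᴴ] **TARGET (X-side) `HLedStepI` — ONE weight-one H-led step, integral carrier**: `HLedStep` with the
state `HLedStateI` in hypothesis and conclusion. Route (N2, owner): pattern `DepthOne.dictionaryStep_mixed` — blow `X` up along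
`Ĉ = C.map i` (regular, inside the Cartier carrier, hence nowhere dense; over the closed point since `V(C)` lies on a charged
member); `i'` := the strict-transform morphism, `i'.ker = σᶜ(𝓘_H, 1)` (`ker_strictTransformHom_of_isRegular`),
`σ^*𝓘_H = Ĉ𝒪 · 𝓘_{H'}`; members THROUGH the centre: `σ^*B = Ĉ𝒪 · σᶜ(B, 1)` (`comap_mul_controlledTransform_one`), the
others: `σᶜ(B, 1) = σ^*B` (`strictTransformIdeal_eq_controlledTransform` at generic weight `0`, on `X` and on `W`); FORMAT
`I𝒪_{X'} = (σ^*M · Ĉ𝒪) · (𝓘_{H'} ⊔ monomialIdeal ℬ')`; restriction along the square `W' → X'` / `W → X`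
(`comap_controlledTransform_of_isEffectiveCartier`); `W'` integral (`IsBlowup.isIntegral`), restrictions Cartier.
(cf. Kollár 2007 = bib Kollar2007, (3.111) Step 3, 3.30.2; BGMW 2011 Lemma 3.2.1 — OURS node; pointer in prose, the Prop being
parameterless) -/
def HLedStepI : Prop :=
  ∀ (S : Type u) [CommRing S] [IsRegularLocalRing S] (I : Ideal S) (W X : Scheme.{u}) (i : W ⟶ X)
    (g : X ⟶ Spec (.of S)) (ℬ : List (X.IdealSheafData × ℕ)),
    HLedStateI S I W X i g ℬ →
    ∀ (W' : Scheme.{u}) (τ : W' ⟶ W) (C : W.IdealSheafData),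
      Scheme.IsRegular C.subscheme → _root_.IsPreconnected (C.support : Set W) →
      1 ≤ weightOf (restrictBoundary i ℬ) (divisorsOver (restrictBoundary i ℬ) C C.support) →
      IsBlowup τ C →
        ∃ (X' : Scheme.{u}) (σ : X' ⟶ X) (i' : W' ⟶ X') (ℬ' : List (X'.IdealSheafData × ℕ)),
          i' ≫ σ = τ ≫ i ∧ IsBlowup σ (C.map i) ∧ HLedStateI S I W' X' i' (σ ≫ g) ℬ' ∧
          restrictBoundary i' ℬ' =
            (restrictBoundary i ℬ).map (fun p => (controlledTransform τ C p.1 1, p.2)) ++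
              [(C.comap τ, weightOf (restrictBoundary i ℬ) (divisorsOver (restrictBoundary i ℬ) C C.support) - 1)]

/-- [OURS · L1 W5.2 · R5ᴴ] **TARGET (X-side) `HLedTowerI` — the weight-one H-led tower, integral carrier**: every `HSepSeq` on
the carrier of an `HLedStateI` is realised by blowings up of `X`, the state re-established, the restricted boundary BEING the
E-side list. PROVED from `HLedStepI` below (`hLedTowerI_of_step`). (cf. Kollár 2007 = bib Kollar2007, (3.111) Step 3; Stacks
080A — OURS node; pointer in prose, the Prop being parameterless) -/
def HLedTowerI : Prop :=
  ∀ (S : Type u) [CommRing S] [IsRegularLocalRing S] (I : Ideal S) (W X : Scheme.{u}) (i : W ⟶ X)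
    (g : X ⟶ Spec (.of S)) (ℬ : List (X.IdealSheafData × ℕ)),
    HLedStateI S I W X i g ℬ →
    ∀ (W' : Scheme.{u}) (ρ : W' ⟶ W) (𝒟' : List (W'.IdealSheafData × ℕ)),
      HSepSeq ρ (restrictBoundary i ℬ) 𝒟' →
        ∃ (X' : Scheme.{u}) (π : X' ⟶ X) (i' : W' ⟶ X') (ℬ' : List (X'.IdealSheafData × ℕ)),
          i' ≫ π = ρ ≫ i ∧ HLedStateI S I W' X' i' (π ≫ g) ℬ' ∧ restrictBoundary i' ℬ' = 𝒟'

/-- **The tower from the step** (PROVED): induction on the game, the X-side data generalised. [cite: StacksProject, Tag 080A] -/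
theorem hLedTowerI_of_step (hstep : HLedStepI.{u}) : HLedTowerI.{u} := by
  intro S _ _ I W X i g ℬ hst W' ρ 𝒟' hseq
  generalize h𝒟 : restrictBoundary i ℬ = 𝒟 at hseq
  induction hseq generalizing X with
  | nil 𝒟 =>
    exact ⟨X, 𝟙 X, i, ℬ, by rw [Category.comp_id, Category.id_comp], by rwa [Category.id_comp], h𝒟⟩
  | cons τ ρ 𝒟 𝒟₁ C _ hC hconn hw hτ ih =>
    obtain ⟨X₁, π₁, i₁, ℬ₁, hcomm₁, hst₁, hres₁⟩ := ih X i g ℬ hst h𝒟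
    subst hres₁
    obtain ⟨X₂, σ, i₂, ℬ₂, hcomm₂, -, hst₂, hres₂⟩ := hstep S I _ X₁ i₁ (π₁ ≫ g) ℬ₁ hst₁ _ τ C hC hconn hw hτ
    refine ⟨X₂, σ ≫ π₁, i₂, ℬ₂, ?_, by rwa [Category.assoc], hres₂⟩
    rw [← Category.assoc, hcomm₂, Category.assoc, hcomm₁, Category.assoc]

/-! ## §3 The PROVED compositions down to the CORE shape -/

/-- **The initial state of a package is an `HLedStateI`.** [cite: Kollar2007, (3.111) Step 3] -/
theorem HLedStateI.of_package {S : Type u} [CommRing S] [IsRegularLocalRing S] {I : Ideal S} {W X : Scheme.{u}}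
    {i : W ⟶ X} {g : X ⟶ Spec (.of S)} {B₀ : X.IdealSheafData} {ℓ : ℕ} (hst : HLedState S I W X i g [(B₀, ℓ)])
    (hint : IsIntegral W) (hcart : IsEffectiveCartier (B₀.comap i)) : HLedStateI S I W X i g [(B₀, ℓ)] where
  __ := hst
  isIntegral_host := hint
  restrict_cartier := fun p hp => by
    rw [List.mem_singleton] at hp
    subst hp
    exact hcart

/-- [OURS · L1 W5.2 · R5ᴴ] **THE RUNG over integral carriers, modulo its two targets: every member with a hypersurface-led
package satisfies the conclusion of the CORE** (`HSepGame₃` E-side ∘ `HLedTowerI` X-side ∘ END `HLedState.atomConclusion_of_end`;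
fact-free as a composition — F-32bR enters only through N3's `hSepGame₃_of_cjsB`). [cite: Kollar2007, (3.111) Step 3] -/
theorem hLedI_atomConclusion_of_targets (hsep : HSepGame₃.{u}) (htower : HLedTowerI.{u})
    (S : Type u) [CommRing S] [IsRegularLocalRing S] (I : Ideal S) (hI : I ≠ ⊥) (hpkg : HLedPackage S I)
    (T : Scheme.{u}) (f : T ⟶ Spec (.of S)) (hf : IsBlowup f (affineBlowup.idealSheaf I)) :
    ∃ (J : T.IdealSheafData) (T' : Scheme.{u}) (π : T' ⟶ T), J ≠ ⊥ ∧
      (∀ t : T, t ∈ J.support → f.base t = IsLocalRing.closedPoint S) ∧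
      IsBlowup π J ∧ Scheme.IsRegular T' := by
  obtain ⟨W, X, i, g, B₀, ℓ, hℓ, hst, hint, hnoeth, hexc, hdim, hcart, hne⟩ := hpkg
  -- E-side: win the game from `[(B₀|_W, ℓ)]`
  obtain ⟨W', ρ, 𝒟', hseq, hend⟩ := hsep W hst.isRegular_host hexc hdim (B₀.comap i) hcart hne ℓ hℓ
  -- X-side: realise it over the integral carrier
  obtain ⟨X', π, i', ℬ', -, hst', hres⟩ :=
    htower S I W X i g [(B₀, ℓ)] (HLedStateI.of_package hst hint hcart) W' ρ 𝒟' hseq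
  -- END
  exact hst'.toHLedState.atomConclusion_of_end hI (hres ▸ hend) T f hf

/-- [OURS · L1 W5.2 · R5ᴴ] **THE RUNG for the member class over integral carriers, modulo `HLedInitial` (N1), `HSepGame₃`
(N3–N5), `HLedStepI` (N2)**: every hypersurface-led one-form member of every depth `ℓ ≥ 1` of a four-dimensional COMPLETE regular
local ring with a coefficient field satisfies the conclusion of the CORE. [cite: Kollar2007, (3.111) Step 3] -/
theorem hLedMemberI_atomConclusion_of_targets (hinit : HLedInitial.{u}) (hsep : HSepGame₃.{u}) (hstep : HLedStepI.{u})
    (S : Type u) [CommRing S] [IsRegularLocalRing S] [IsAdicComplete (IsLocalRing.maximalIdeal S) S]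
    (hdim : ringKrullDim S = (3 + 1 : ℕ))
    (κ₀ : Type u) [Field κ₀] (σ : κ₀ →+* S) (hσ : Function.Bijective ⇑((IsLocalRing.residue S).comp σ))
    (x : Fin (3 + 1) → S) (hx : Ideal.span (Set.range x) = IsLocalRing.maximalIdeal S)
    (d ℓ : ℕ) (P₀ : Fin 1 → MvPolynomial (Fin (3 + 1)) κ₀)
    (hP₀ : ∀ l, P₀ l ∈ MvPolynomial.homogeneousSubmodule (Fin (3 + 1)) κ₀ d)
    (P₁ : Fin 1 → MvPolynomial (Fin (3 + 1)) κ₀)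
    (hP₁ : ∀ l, P₁ l ∈ MvPolynomial.homogeneousSubmodule (Fin (3 + 1)) κ₀ (d + 1))
    (G : Fin 1 → S) (hG : ∀ l, G l ∈ IsLocalRing.maximalIdeal S ^ (d + 2)) (hP00 : P₀ 0 ≠ 0) (hd : 1 ≤ d) (hℓ : 1 ≤ ℓ)
    (hprime : (Ideal.span {MvPolynomial.eval₂Hom σ x (P₀ 0) + MvPolynomial.eval₂Hom σ x (P₁ 0) + G 0}).IsPrime)
    (hled : IsHypersurfaceLed κ₀ d P₀ P₁ hP₀ hP₁)
    (hI : oneFormMemberIdeal σ x d ℓ P₀ P₁ G ≠ ⊥)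
    (T : Scheme.{u}) (f : T ⟶ Spec (.of S)) (hf : IsBlowup f (affineBlowup.idealSheaf (oneFormMemberIdeal σ x d ℓ P₀ P₁ G))) :
    ∃ (J : T.IdealSheafData) (T' : Scheme.{u}) (π : T' ⟶ T), J ≠ ⊥ ∧
      (∀ t : T, t ∈ J.support → f.base t = IsLocalRing.closedPoint S) ∧
      IsBlowup π J ∧ Scheme.IsRegular T' :=
  hLedI_atomConclusion_of_targets hsep (hLedTowerI_of_step hstep) S _ hI
    (hinit S hdim κ₀ σ hσ x hx d ℓ P₀ hP₀ P₁ hP₁ G hG hP00 hd hℓ hprime hled) T f hf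

end Summit.ResolutionOfSingularities.ResolutionOfSingularities.Theorems.DepthTargets

end
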